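import Literature.AlgebraicGeometry.AbelianSchemes.AbelianSchemeSymplecticLevel
import Literature.AlgebraicGeometry.AbelianSchemes.LevelStructureChangeLevel
import Literature.AlgebraicGeometry.AbelianSchemes.AbelianSchemeOverRestrictPt
import HarnessLib

/-!
# Symplectic-liftability descends along the level change `σ ↦ σ^d`
# ([Lan2013PELCompactifications, §1.3.6]; cell hodgecm-mathlib, M1PRIME-DAG rung 0, W2 (c5))

[Lan2013PELCompactifications, Def. 1.3.6.2 (p. 80) / Lemma 1.3.6.5 (p. 81)]: a level structure `α_n` is symplectic-
liftable when «there exists (noncanonically) [a] symplectic isomorphism `α̂ : L ⊗ Ẑ ⥲ T A_s̄` lifting `α_{n,s̄}` … as a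
reduction mod `n` of `α̂`»; [Deligne1971TravauxShimura, 4.12 (b) (p. 149)] «isomorphismes `k_n` … qui peuvent se relever
en des isomorphismes symplectiques `k : T(B) ⥲ V_ẑ`».  If `φ = (σᵢ)` is such a level-`N` structure and `N = N' d`, the
level-`N'` structure `φ.changeLevel N' d = (σᵢ ^ d)` (★ `LevelStructureChangeLevel`) is again symplectic-liftable: the
SAME `α̂`, reduced mod `N'`.  In the carrier ★ `AbelianSchemeSymplecticLevel` a symplectic lift is a TOWER
`lift M : (ℤ/M)^{2g} →* A_s[M](Ω)` over the levels `N ∣ M` with roots of unity `ζ_M`; the level-`N'` tower needs the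
COFINAL RE-INDEXING `N' ∣ M ⇔ N ∣ d·M`: `ζ'_M := ζ_{dM}^d`, `lift'_M := [d] ∘ lift_{dM} ∘ (canonical lift
(ℤ/M)^{2g} → (ℤ/dM)^{2g})`.  Field by field: primitivity (`IsPrimitiveRoot.pow_of_dvd`), root compatibility, bijectivity
(injectivity of `lift_{dM}` and the divisibility `d ∣ w` forced on `M`-torsion exponents — no divisibility of points is
used), tower compatibility, `lift'_{N'}(eᵢ) = σᵢ(s)^d`, and the pairing clause from ★
`Motives.AbelianVariety.weilPairingLevel_level_mul` («`ē_{dM}(P, Q) = ē_M(P^d, Q)`», [Lang1983AbelianVarieties] VII §2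
Prop. 5) with the bookkeeping `E_δ(x̃, d ỹ) ≡ d · E_δ(x, y) (mod dM)`.  All DATA is cast-free (indexed through `d * M`);
the `N = N' d` bookkeeping is confined to proofs (`lift_congr`).

## Main definitions and results
* `AbelianSchemeOver.typeFormMod_nsmul_right`, `castHom_typeFormMod` — `E_δ` is `ℤ/n`-linear in the second slot and
  commutes with reduction `ℤ/n → ℤ/m`.
* `LevelStructure.SymplecticLift.lift_congr`, `pow_lift_eq_of_cast_eq` — the dependent index of the tower; two lifts of
  the same vector mod `M` agree under `[d] ∘ lift_{dM}`.
* `LevelStructure.SymplecticLift.liftPow` (+ `coe_liftPow_ofAdd_of_cast_eq`, `coe_liftPow_ofAdd_eq_lift_nsmul`) — the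
  re-indexed tower as homomorphisms.
* `LevelStructure.SymplecticLift.changeLevel` — THE SYMPLECTIC LIFT OF `φ.changeLevel N' d` built from one of `φ`;
  `changeLevel_lift` (by `rfl`).
* `LevelStructure.IsSymplecticLiftable.changeLevel` — symplectic-liftability descends along the level change.

Cell hodgecm-mathlib, #60 Mumford line, rung 0 (director s91 (2): additive module downstream of the D3 carrier);
B-plan1 P30 / CENSUS-W2 §2 (c5); prover seat B-p09.  HC_CM is proved only modulo the 7 printed citations until rung 0
closes; this file discharges none of them.

## References
* [Lan2013PELCompactifications] K.-W. Lan, *Arithmetic compactifications of PEL-type Shimura varieties*, LMS Monographs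
  36 (2013), §1.3.6 Def. 1.3.6.1–1.3.6.2 (pp. 79–80), Lemma 1.3.6.5 (p. 81).
* [Deligne1971TravauxShimura] P. Deligne, *Travaux de Shimura*, Sém. Bourbaki 389 (1971), 4.12 (b) (p. 149), 4.16 (p. 150).
* [Lang1983AbelianVarieties] S. Lang, *Abelian Varieties* (1983), Ch. VII §2 Prop. 5.
* [GenestierNgo2020] A. Genestier, B. C. Ngô, *Lectures on Shimura varieties*, §1.3 (1.3.1).
* Tree: ★ `AbelianSchemeSymplecticLevel` (`SymplecticLift`, `IsSymplecticLiftable`, `typeFormMod`),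
  ★ `LevelStructureChangeLevel`, ★ `AbelianSchemeOverRestrictPt` (`restrictPt_pow`),
  ★ `Motives.AbelianVarietyWeilPairingLevel` (`weilPairingLevel_level_mul`, `torsionPointsPow`, `torsionPointsOfDvd`).
-/

universe u

open CategoryTheory CategoryTheory.Limits AlgebraicGeometry MonoidalCategory

noncomputable section

namespace Literature.AlgebraicGeometry.AbelianSchemes

open Literature.AlgebraicGeometry.Motives Literature.AlgebraicGeometry.AbelianVarieties
open scoped MonObj

namespace AbelianSchemeOver

/-! ### `typeFormMod` bookkeeping: scaling the second argument, reduction along `m ∣ n` -/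

/-- `E_δ(x, c • y) = c • E_δ(x, y)` (`ℤ/n`-bilinearity in the second slot). [cite: GenestierNgo2020, §1.3 (1.3.1)] -/
theorem typeFormMod_nsmul_right {g : ℕ} (δ : Fin g → ℕ) (n c : ℕ) (x y : Fin g ⊕ Fin g → ZMod n) :
    typeFormMod δ n x (c • y) = c • typeFormMod δ n x y := by
  simp only [typeFormMod, Pi.smul_apply, nsmul_eq_mul, Finset.mul_sum]
  refine Finset.sum_congr rfl fun i _ => Finset.sum_congr rfl fun j _ => ?_
  ring

/-- `E_δ` commutes with the reduction `ℤ/n → ℤ/m`, `m ∣ n`. [cite: GenestierNgo2020, §1.3 (1.3.1)] -/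
theorem castHom_typeFormMod {g : ℕ} (δ : Fin g → ℕ) {m n : ℕ} (h : m ∣ n) (x y : Fin g ⊕ Fin g → ZMod n) :
    ZMod.castHom h (ZMod m) (typeFormMod δ n x y) =
      typeFormMod δ m (fun k => ZMod.castHom h (ZMod m) (x k)) fun k => ZMod.castHom h (ZMod m) (y k) := by
  simp only [typeFormMod, map_sum, map_mul, map_intCast]

namespace LevelStructure

namespace SymplecticLift

variable {S : Scheme.{u}} {A : AbelianSchemeOver S} {g N : ℕ} {φ : A.LevelStructure g N} {Ω : Type u} [Field Ω]
  {s : Spec (.of Ω) ⟶ S} {Θ : CartierDivisor (A.fibre s).toAbelianVariety.X.left} {δ : Fin g → ℕ}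
  (Λ : φ.SymplecticLift s Θ δ)

/-! ### Helpers: the dependent index of the tower, and «two lifts of the same class agree after `^d`» -/

/-- `lift` along EQUAL levels `a = b` agree through `ZMod.cast` (proof-only helper for the dependent index).
[cite: Lan2013PELCompactifications, §1.3.6 Lemma 1.3.6.5 (p. 81)] -/
theorem lift_congr {a b : ℕ} (h : a = b) (x : Fin g ⊕ Fin g → ZMod a) :
    ((Λ.lift a (Multiplicative.ofAdd x)) : (A.fibre s).toAbelianVariety.Points Ω) =
      Λ.lift b (Multiplicative.ofAdd fun k => (ZMod.cast (x k) : ZMod b)) := by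
  subst h
  congr 2
  funext k
  exact (ZMod.cast_id _ _).symm

/-- **Two lifts to `(ℤ/dM)^{2g}` of the same vector of `(ℤ/M)^{2g}` have the same image under `[d] ∘ lift_{dM}`**:
their difference is `M • c`, and `lift_{dM}(M • c)^d = lift_{dM}(c)^{dM} = 1`. [cite: Lan2013PELCompactifications, §1.3.6 Lemma 1.3.6.5 (p. 81)] -/
theorem pow_lift_eq_of_cast_eq {d M : ℕ} (hd : d ≠ 0) (hM : M ≠ 0) (u v : Fin g ⊕ Fin g → ZMod (d * M))
    (huv : ∀ k, (ZMod.cast (u k) : ZMod M) = ZMod.cast (v k)) :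
    ((Λ.lift (d * M) (Multiplicative.ofAdd u)) : (A.fibre s).toAbelianVariety.Points Ω) ^ d =
      ((Λ.lift (d * M) (Multiplicative.ofAdd v)) : (A.fibre s).toAbelianVariety.Points Ω) ^ d := by
  haveI : NeZero (d * M) := ⟨Nat.mul_ne_zero hd hM⟩
  haveI : NeZero M := ⟨hM⟩
  -- `u = v + M • c` with `c k := (u k - v k).val / M`
  have hdiv : ∀ k, M ∣ (u k - v k).val := fun k => by
    have h0 : (ZMod.cast (u k - v k) : ZMod M) = 0 := by
      rw [ZMod.cast_sub (dvd_mul_left M d), huv k, sub_self]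
    rw [ZMod.cast_eq_val, ZMod.natCast_eq_zero_iff] at h0
    exact h0
  have huvc : u = v + M • fun k => (((u k - v k).val / M : ℕ) : ZMod (d * M)) := by
    funext k
    have hk : u k - v k = (M : ZMod (d * M)) * (((u k - v k).val / M : ℕ) : ZMod (d * M)) := by
      rw [← Nat.cast_mul, Nat.mul_div_cancel' (hdiv k), ZMod.natCast_zmod_val]
    rw [Pi.add_apply, Pi.smul_apply, nsmul_eq_mul, ← hk, add_sub_cancel]
  rw [huvc, ofAdd_add, ofAdd_nsmul, map_mul, map_pow, Subgroup.coe_mul, Subgroup.coe_pow, mul_pow, ← pow_mul,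
    Nat.mul_comm M d, AbelianVariety.coe_torsionPoints_pow_eq_one, mul_one]

/-- THE RE-INDEXED TOWER (data): `lift'_M := [d] ∘ lift_{dM} ∘ (canonical lift)` as a homomorphism
`(ℤ/M)^{2g} →* A_s[M](Ω)` (for `M = 0` the trivial homomorphism — never read).  Multiplicativity is
`pow_lift_eq_of_cast_eq` applied to the carry of `val`-addition. [cite: Lan2013PELCompactifications, §1.3.6 Lemma 1.3.6.5 (p. 81)] -/
def liftPow (d : ℕ) (hd : d ≠ 0) (M : ℕ) :
    Multiplicative (Fin g ⊕ Fin g → ZMod M) →* (A.fibre s).toAbelianVariety.torsionPoints Ω (M : ℤ) :=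
  if hM : M = 0 then 1 else
  { toFun := fun x => (A.fibre s).toAbelianVariety.torsionPointsPow d
      (Λ.lift (d * M) (Multiplicative.ofAdd fun k => ((Multiplicative.toAdd x k).val : ZMod (d * M))))
    map_one' := by
      apply Subtype.ext
      rw [AbelianVariety.coe_torsionPointsPow]
      have h0 : (fun k => (((Multiplicative.toAdd (1 : Multiplicative (Fin g ⊕ Fin g → ZMod M))) k).val :
          ZMod (d * M))) = 0 := by
        funext k
        rw [toAdd_one, Pi.zero_apply, ZMod.val_zero, Nat.cast_zero, Pi.zero_apply]
      simp only [h0, ofAdd_zero, map_one, OneMemClass.coe_one, one_pow]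
    map_mul' := fun x y => by
      haveI : NeZero M := ⟨hM⟩
      apply Subtype.ext
      rw [Subgroup.coe_mul, AbelianVariety.coe_torsionPointsPow, AbelianVariety.coe_torsionPointsPow,
        AbelianVariety.coe_torsionPointsPow, ← mul_pow, ← Subgroup.coe_mul, ← map_mul, ← ofAdd_add]
      refine Λ.pow_lift_eq_of_cast_eq hd hM _ _ fun k => ?_
      rw [Pi.add_apply, ZMod.cast_add (dvd_mul_left M d), ZMod.cast_natCast (dvd_mul_left M d),
        ZMod.cast_natCast (dvd_mul_left M d), ZMod.cast_natCast (dvd_mul_left M d), ZMod.natCast_zmod_val,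
        ZMod.natCast_zmod_val, ZMod.natCast_zmod_val, toAdd_mul, Pi.add_apply] }

/-- `liftPow` read through ANY lift `u` of `x` to `(ℤ/dM)^{2g}` (`M ≠ 0`). [cite: Lan2013PELCompactifications, §1.3.6 Lemma 1.3.6.5 (p. 81)] -/
theorem coe_liftPow_ofAdd_of_cast_eq (d : ℕ) (hd : d ≠ 0) {M : ℕ} (hM : M ≠ 0) (x : Fin g ⊕ Fin g → ZMod M)
    (u : Fin g ⊕ Fin g → ZMod (d * M)) (hu : ∀ k, (ZMod.cast (u k) : ZMod M) = x k) :
    ((Λ.liftPow d hd M (Multiplicative.ofAdd x)) : (A.fibre s).toAbelianVariety.Points Ω) =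
      ((Λ.lift (d * M) (Multiplicative.ofAdd u)) : (A.fibre s).toAbelianVariety.Points Ω) ^ d := by
  haveI : NeZero M := ⟨hM⟩
  rw [liftPow, dif_neg hM]
  change ((Λ.lift (d * M) (Multiplicative.ofAdd fun k => ((x k).val : ZMod (d * M)))) :
      (A.fibre s).toAbelianVariety.Points Ω) ^ d = _
  refine Λ.pow_lift_eq_of_cast_eq hd hM _ _ fun k => ?_
  rw [ZMod.cast_natCast (dvd_mul_left M d), ZMod.natCast_zmod_val, hu]

/-- `[d] ∘ lift_{dM} ∘ (canonical lift) = lift_{dM} ∘ (d • canonical lift)` (`M ≠ 0`).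
[cite: Lan2013PELCompactifications, §1.3.6 Lemma 1.3.6.5 (p. 81)] -/
theorem coe_liftPow_ofAdd_eq_lift_nsmul (d : ℕ) (hd : d ≠ 0) {M : ℕ} (hM : M ≠ 0) (x : Fin g ⊕ Fin g → ZMod M) :
    ((Λ.liftPow d hd M (Multiplicative.ofAdd x)) : (A.fibre s).toAbelianVariety.Points Ω) =
      Λ.lift (d * M) (Multiplicative.ofAdd (d • fun k => ((x k).val : ZMod (d * M)))) := by
  haveI : NeZero M := ⟨hM⟩
  rw [Λ.coe_liftPow_ofAdd_of_cast_eq d hd hM x (fun k => ((x k).val : ZMod (d * M)))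
      fun k => by rw [ZMod.cast_natCast (dvd_mul_left M d), ZMod.natCast_zmod_val],
    ofAdd_nsmul, map_pow, Subgroup.coe_pow]

/-! ### The level change of a symplectic lift -/

/-- **THE SYMPLECTIC LIFT OF `φ.changeLevel N' d` BUILT FROM A SYMPLECTIC LIFT OF `φ`** (W2 (c5), data): roots
`ζ'_M := ζ_{dM}^d`, tower `lift'_M := [d] ∘ lift_{dM} ∘ lift` — Lan's «the same `α̂`, reduced mod `N'`».  Field by field:
primitivity by `IsPrimitiveRoot.pow_of_dvd`; root compatibility from `ζ_pow` at `dM ∣ k·dM`; bijectivity by injectivity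
of `lift_{dM}` and the divisibility `d ∣ w` forced on `M`-torsion exponents (no divisibility of POINTS is used); tower
compatibility from `lift_compat` at `dM ∣ k·dM` through `lift_congr`; `lift'_{N'}(eᵢ) = σᵢ(s)^d` from `lift_level` and
(O4) `restrictPt_pow`; the pairing clause from ★ `weilPairingLevel_level_mul` («`ē_{dM}(P, Q) = ē_M(P^d, Q)`») and the
`typeFormMod` bookkeeping `E_{dM}(x̃, d ỹ) ≡ d·E_M(x, y) (mod dM)`.
[cite: Lan2013PELCompactifications, §1.3.6 Def. 1.3.6.2 (p. 80) and Lemma 1.3.6.5 (p. 81)] [cite: Deligne1971TravauxShimura, 4.12 (b) p. 149] -/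
def changeLevel (N' d : ℕ) (hd : N = N' * d) (hN : N ≠ 0) : (φ.changeLevel N' d hd hN).SymplecticLift s Θ δ :=
  have hd0 : d ≠ 0 := by rintro rfl; exact hN (by rw [hd, mul_zero])
  have hNd : ∀ {M : ℕ}, N' ∣ M → N ∣ d * M := fun {M} h => by
    rw [hd, mul_comm N' d]; exact Nat.mul_dvd_mul_left d h
  { ζ := fun M => Λ.ζ (d * M) ^ d
    isPrimitiveRoot_ζ := fun M hM hM0 => by
      have h := (Λ.isPrimitiveRoot_ζ (hNd hM) (Nat.mul_ne_zero hd0 hM0)).pow_of_dvd hd0 (dvd_mul_right d M)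
      rwa [Nat.mul_div_cancel_left M (Nat.pos_of_ne_zero hd0)] at h
    ζ_pow := fun M k hM hM0 hk0 => by
      show (Λ.ζ (d * (k * M)) ^ d) ^ k = Λ.ζ (d * M) ^ d
      rw [← pow_mul, Nat.mul_comm d k, pow_mul, Nat.mul_left_comm d k M,
        Λ.ζ_pow k (hNd hM) (Nat.mul_ne_zero hd0 hM0) hk0]
    lift := Λ.liftPow d hd0
    lift_bijective := fun M hM hM0 => by
      haveI : NeZero M := ⟨hM0⟩
      haveI : NeZero (d * M) := ⟨Nat.mul_ne_zero hd0 hM0⟩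
      have hinj := (Λ.lift_bijective (hNd hM) (Nat.mul_ne_zero hd0 hM0)).1
      have hlt : ∀ c : ZMod M, d * c.val < d * M := fun c =>
        Nat.mul_lt_mul_of_pos_left (ZMod.val_lt c) (Nat.pos_of_ne_zero hd0)
      constructor
      · -- injective: `d • x̃ = d • ỹ` in `(ℤ/dM)^{2g}` forces `x = y`
        intro x y hxy
        have h : Λ.lift (d * M) (Multiplicative.ofAdd (d • fun k => (((Multiplicative.toAdd x) k).val : ZMod (d * M)))) =
            Λ.lift (d * M) (Multiplicative.ofAdd (d • fun k => (((Multiplicative.toAdd y) k).val : ZMod (d * M)))) := by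
          apply Subtype.ext
          rw [← Λ.coe_liftPow_ofAdd_eq_lift_nsmul d hd0 hM0, ← Λ.coe_liftPow_ofAdd_eq_lift_nsmul d hd0 hM0,
            ofAdd_toAdd, ofAdd_toAdd, hxy]
        have h' := congrArg Multiplicative.toAdd (hinj h)
        rw [toAdd_ofAdd, toAdd_ofAdd] at h'
        apply Multiplicative.toAdd.injective
        funext k
        have hk := congrArg ZMod.val (congrFun h' k)
        rw [Pi.smul_apply, Pi.smul_apply, nsmul_eq_mul, nsmul_eq_mul, ← Nat.cast_mul, ← Nat.cast_mul,
          ZMod.val_natCast, ZMod.val_natCast, Nat.mod_eq_of_lt (hlt _), Nat.mod_eq_of_lt (hlt _)] at hk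
        exact ZMod.val_injective M (Nat.eq_of_mul_eq_mul_left (Nat.pos_of_ne_zero hd0) hk)
      · -- surjective: an `M`-torsion point is `lift_{dM}(w)` with `M • w = 0`, i.e. `w = d • x̃`
        intro P
        have hPdM : ((P : (A.fibre s).toAbelianVariety.Points Ω)) ∈
            (A.fibre s).toAbelianVariety.torsionPoints Ω ((d * M : ℕ) : ℤ) := by
          rw [AbelianVariety.mem_torsionPoints_iff, zpow_natCast, pow_mul',
            AbelianVariety.coe_torsionPoints_pow_eq_one, one_pow]
        obtain ⟨w', hw'⟩ := (Λ.lift_bijective (hNd hM) (Nat.mul_ne_zero hd0 hM0)).2 ⟨_, hPdM⟩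
        set w : Fin g ⊕ Fin g → ZMod (d * M) := Multiplicative.toAdd w' with hwdef
        have hw'' : Multiplicative.ofAdd w = w' := ofAdd_toAdd w'
        -- `M • w = 0`
        have hMw : M • w = 0 := by
          have h1 : Λ.lift (d * M) (Multiplicative.ofAdd (M • w)) = 1 := by
            apply Subtype.ext
            rw [ofAdd_nsmul, map_pow, Subgroup.coe_pow, hw'', hw', OneMemClass.coe_one]
            exact AbelianVariety.coe_torsionPoints_pow_eq_one P
          have h2 := congrArg Multiplicative.toAdd (hinj (h1.trans (map_one _).symm))
          rwa [toAdd_ofAdd, toAdd_one] at h2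
        have hdvd : ∀ k, d ∣ (w k).val := fun k => by
          have hk : ((M * (w k).val : ℕ) : ZMod (d * M)) = 0 := by
            have h := congrFun hMw k
            rw [Pi.smul_apply, Pi.zero_apply, nsmul_eq_mul] at h
            rw [Nat.cast_mul, ZMod.natCast_zmod_val]
            exact h
          rw [ZMod.natCast_eq_zero_iff] at hk
          have hk' : M * d ∣ M * (w k).val := by rw [Nat.mul_comm M d]; exact hk
          exact Nat.dvd_of_mul_dvd_mul_left (Nat.pos_of_ne_zero hM0) hk'
        set a : Fin g ⊕ Fin g → ZMod M := fun k => (((w k).val / d : ℕ) : ZMod M) with hadef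
        refine ⟨Multiplicative.ofAdd a, Subtype.ext ?_⟩
        rw [Λ.coe_liftPow_ofAdd_eq_lift_nsmul d hd0 hM0]
        have hvec : (d • fun k => ((a k).val : ZMod (d * M))) = w := by
          funext k
          rw [Pi.smul_apply, nsmul_eq_mul, hadef]
          dsimp only
          rw [ZMod.val_natCast, Nat.mod_eq_of_lt (Nat.div_lt_of_lt_mul ?_), ← Nat.cast_mul,
            Nat.mul_div_cancel' (hdvd k), ZMod.natCast_zmod_val]
          exact ZMod.val_lt _
        rw [hvec, hw'', hw']
    lift_compat := fun M k x hM hM0 hk0 => by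
      haveI : NeZero M := ⟨hM0⟩
      haveI : NeZero (k * M) := ⟨Nat.mul_ne_zero hk0 hM0⟩
      haveI : NeZero (d * M) := ⟨Nat.mul_ne_zero hd0 hM0⟩
      haveI : NeZero (k * (d * M)) := ⟨Nat.mul_ne_zero hk0 (Nat.mul_ne_zero hd0 hM0)⟩
      -- the lift `y` of `x ∈ (ℤ/kM)^{2g}` to level `k·(dM)` (the index Λ's compatibility wants)
      have hR : ((Λ.liftPow d hd0 (k * M) (Multiplicative.ofAdd x) :
              (A.fibre s).toAbelianVariety.torsionPoints Ω ((k * M : ℕ) : ℤ)) :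
            (A.fibre s).toAbelianVariety.Points Ω) =
          ((Λ.lift (k * (d * M)) (Multiplicative.ofAdd fun i => ((x i).val : ZMod (k * (d * M))))) :
            (A.fibre s).toAbelianVariety.Points Ω) ^ d := by
        rw [Λ.coe_liftPow_ofAdd_of_cast_eq d hd0 (Nat.mul_ne_zero hk0 hM0) x
            (fun i => ((x i).val : ZMod (d * (k * M))))
            fun i => by rw [ZMod.cast_natCast (dvd_mul_left (k * M) d), ZMod.natCast_zmod_val],
          Λ.lift_congr (Nat.mul_left_comm d k M)]
        congr 3
        funext i
        exact ZMod.cast_natCast (dvd_of_eq (Nat.mul_left_comm k d M)) _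
      have hL : ((Λ.liftPow d hd0 M (Multiplicative.ofAdd fun i =>
              ZMod.castHom (Dvd.intro_left k rfl) (ZMod M) (x i)) :
              (A.fibre s).toAbelianVariety.torsionPoints Ω (M : ℤ)) : (A.fibre s).toAbelianVariety.Points Ω) =
          ((Λ.lift (d * M) (Multiplicative.ofAdd fun i =>
              ZMod.castHom (Dvd.intro_left k rfl) (ZMod (d * M)) ((x i).val : ZMod (k * (d * M))))) :
            (A.fibre s).toAbelianVariety.Points Ω) ^ d := by
        refine Λ.coe_liftPow_ofAdd_of_cast_eq d hd0 hM0 _ _ fun i => ?_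
        rw [ZMod.castHom_apply, ZMod.castHom_apply, ZMod.cast_natCast (Dvd.intro_left k rfl),
          ZMod.cast_natCast (dvd_mul_left M d), ZMod.cast_eq_val]
      change ((Λ.liftPow d hd0 M _ : (A.fibre s).toAbelianVariety.torsionPoints Ω (M : ℤ)) :
          (A.fibre s).toAbelianVariety.Points Ω) =
        ((Λ.liftPow d hd0 (k * M) (Multiplicative.ofAdd x) :
          (A.fibre s).toAbelianVariety.torsionPoints Ω ((k * M : ℕ) : ℤ)) : (A.fibre s).toAbelianVariety.Points Ω) ^ k
      rw [hL, hR, ← pow_mul, Nat.mul_comm d k, pow_mul,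
        Λ.lift_compat k (fun i => ((x i).val : ZMod (k * (d * M)))) (hNd hM) (Nat.mul_ne_zero hd0 hM0) hk0]
    lift_level := fun i => by
      haveI : NeZero N' := ⟨by rintro rfl; exact hN (by rw [hd, zero_mul])⟩
      change ((Λ.liftPow d hd0 N' (Multiplicative.ofAdd (Pi.single i 1)) :
          (A.fibre s).toAbelianVariety.torsionPoints Ω (N' : ℤ)) : (A.fibre s).toAbelianVariety.Points Ω) =
        A.restrictPt s ((φ.changeLevel N' d hd hN).σ i)
      rw [LevelStructure.changeLevel_σ, restrictPt_pow, ← Λ.lift_level i,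
        Λ.lift_congr (hd.trans (Nat.mul_comm N' d)) (Pi.single i 1)]
      refine Λ.coe_liftPow_ofAdd_of_cast_eq d hd0 (NeZero.ne N') _ _ fun k => ?_
      rcases eq_or_ne k i with rfl | hk
      · rw [Pi.single_eq_same, Pi.single_eq_same, ZMod.cast_one (dvd_of_eq (hd.trans (Nat.mul_comm N' d)).symm),
          ZMod.cast_one (dvd_mul_left N' d)]
      · rw [Pi.single_eq_of_ne hk, Pi.single_eq_of_ne hk, ZMod.cast_zero, ZMod.cast_zero]
    pairing := fun M hM hMΩ x y => by
      have hM0 : M ≠ 0 := by rintro rfl; exact hMΩ (by rw [Nat.cast_zero])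
      haveI : NeZero M := ⟨hM0⟩
      haveI : NeZero (d * M) := ⟨Nat.mul_ne_zero hd0 hM0⟩
      have hprim := Λ.isPrimitiveRoot_ζ (hNd hM) (Nat.mul_ne_zero hd0 hM0)
      have hdMΩ : ((d * M : ℕ) : Ω) ≠ 0 := (hprim.neZero' (R := Ω)).ne
      have hdΩ : (d : Ω) ≠ 0 := by
        intro h; apply hdMΩ; rw [Nat.cast_mul, h, zero_mul]
      letI := AbelianVariety.isDominant_toSchemeHom_zsmul_of_ne_zero (A.fibre s).toAbelianVariety hMΩ
      letI := AbelianVariety.isDominant_toSchemeHom_zsmul_of_ne_zero (A.fibre s).toAbelianVariety hdMΩ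
      letI := AbelianVariety.isDominant_toSchemeHom_zsmul_of_ne_zero (A.fibre s).toAbelianVariety hdΩ
      -- the lifts at level `dM`
      have ex : Λ.liftPow d hd0 M (Multiplicative.ofAdd x) = (A.fibre s).toAbelianVariety.torsionPointsPow d
          (Λ.lift (d * M) (Multiplicative.ofAdd fun k => ((x k).val : ZMod (d * M)))) := by
        rw [liftPow, dif_neg hM0]; rfl
      have ey : Λ.liftPow d hd0 M (Multiplicative.ofAdd y) = (A.fibre s).toAbelianVariety.torsionPointsPow d
          (Λ.lift (d * M) (Multiplicative.ofAdd fun k => ((y k).val : ZMod (d * M)))) := by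
        rw [liftPow, dif_neg hM0]; rfl
      change (A.fibre s).toAbelianVariety.weilPairingLevel Θ (Λ.liftPow d hd0 M (Multiplicative.ofAdd x))
          (Λ.liftPow d hd0 M (Multiplicative.ofAdd y)) = (Λ.ζ (d * M) ^ d) ^ (typeFormMod δ M x y).val
      rw [ex, ey, ← AbelianVariety.weilPairingLevel_level_mul]
      -- `ofDvd d (pow d Q) = Q ^ d` in `A_s[dM]`, then `lift (d • ỹ)`
      have hq : (A.fibre s).toAbelianVariety.torsionPointsOfDvd d ((A.fibre s).toAbelianVariety.torsionPointsPow d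
            (Λ.lift (d * M) (Multiplicative.ofAdd fun k => ((y k).val : ZMod (d * M))))) =
          Λ.lift (d * M) (Multiplicative.ofAdd (d • fun k => ((y k).val : ZMod (d * M)))) := by
        apply Subtype.ext
        rw [AbelianVariety.coe_torsionPointsOfDvd, AbelianVariety.coe_torsionPointsPow, ofAdd_nsmul, map_pow,
          Subgroup.coe_pow]
      rw [hq, Λ.weilPairingLevel_lift (hNd hM) hdMΩ, ← pow_mul]
      -- ⊢ ζ_{dM} ^ (E_{dM}(x̃, d • ỹ)).val = ζ_{dM} ^ (d * (E_M(x, y)).val): compare exponents mod `dM`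
      have hζ1 : Λ.ζ (d * M) ^ (d * M) = 1 := Λ.ζ_pow_eq_one (hNd hM) (Nat.mul_ne_zero hd0 hM0)
      set a := typeFormMod δ (d * M) (fun k => ((x k).val : ZMod (d * M))) fun k => ((y k).val : ZMod (d * M))
        with ha
      have hred : (ZMod.castHom (dvd_mul_left M d) (ZMod M)) a = typeFormMod δ M x y := by
        rw [ha, castHom_typeFormMod]
        congr 1 <;> funext k <;>
          rw [ZMod.castHom_apply, ZMod.cast_natCast (dvd_mul_left M d), ZMod.natCast_zmod_val]
      have hmodM : a.val ≡ (typeFormMod δ M x y).val [MOD M] := by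
        rw [← ZMod.natCast_eq_natCast_iff, ZMod.natCast_zmod_val, ← hred, ZMod.castHom_apply, ZMod.cast_eq_val]
      have hmod : (typeFormMod δ (d * M) (fun k => ((x k).val : ZMod (d * M)))
            (d • fun k => ((y k).val : ZMod (d * M)))).val ≡ d * (typeFormMod δ M x y).val [MOD d * M] := by
        rw [typeFormMod_nsmul_right, ← ha, nsmul_eq_mul, ZMod.val_mul, ZMod.val_natCast]
        exact ((Nat.mod_modEq _ _).trans ((Nat.mod_modEq d (d * M)).mul_right a.val)).trans (hmodM.mul_left' d)
      rw [pow_eq_pow_mod _ hζ1,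
        show (typeFormMod δ (d * M) (fun k => ((x k).val : ZMod (d * M))) (d • fun k => ((y k).val : ZMod (d * M)))).val %
            (d * M) = d * (typeFormMod δ M x y).val % (d * M) from hmod,
        ← pow_eq_pow_mod _ hζ1] }

/-- The re-indexed tower of `Λ.changeLevel` IS `liftPow` (by construction). [cite: Lan2013PELCompactifications, §1.3.6 Lemma 1.3.6.5 (p. 81)] -/
theorem changeLevel_lift (N' d : ℕ) (hd : N = N' * d) (hN : N ≠ 0) (hd0 : d ≠ 0) (M : ℕ) :
    (Λ.changeLevel N' d hd hN).lift M = Λ.liftPow d hd0 M := rfl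

end SymplecticLift

/-- **(c5) SYMPLECTIC-LIFTABILITY DESCENDS ALONG THE LEVEL CHANGE**: if `φ` is symplectic-liftable of type `δ` for
`pol`, so is `φ.changeLevel N' d` (`N = N' d`) — at every geometric point and ample witness, `Λ ↦ Λ.changeLevel`.
[cite: Lan2013PELCompactifications, §1.3.6 Def. 1.3.6.2 (p. 80) and Lemma 1.3.6.5 (p. 81)] [cite: Deligne1971TravauxShimura, 4.12 (b) p. 149] -/
theorem IsSymplecticLiftable.changeLevel {S : Scheme.{u}} {A : AbelianSchemeOver S} {g N : ℕ}
    {φ : A.LevelStructure g N} {D : A.DualPair} {pol : A.Polarization D} {δ : Fin g → ℕ}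
    (h : φ.IsSymplecticLiftable pol δ) (N' d : ℕ) (hd : N = N' * d) (hN : N ≠ 0) :
    (φ.changeLevel N' d hd hN).IsSymplecticLiftable pol δ :=
  fun Ω _ _ s Θ hΘ hlam => (h Ω s Θ hΘ hlam).map fun Λ => Λ.changeLevel N' d hd hN

end LevelStructure

end AbelianSchemeOver

end Literature.AlgebraicGeometry.AbelianSchemes

end
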